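import Literature.AlgebraicGeometry.Motives.DiagonalHypersurfaceFiniteFieldCohomology
import Literature.AlgebraicGeometry.Motives.ZetaFunctionPoleOrderTateConjecture
import HarnessLib

/-!
# Off the middle codimension of the diagonal hypersurface `X = V₊(Σ βᵢ xᵢ^d) ⊂ ℙⁿ⁺¹_{𝔽_q}` (`d ∣ q − 1`): the pole of
# `Z(X, T)` at `q^{−r}` is simple, and Tate's `Tʳ`, `T^{n−r}`, the semisimplicity of `1` on `H^{2r}(X)(r)` and
# «hom = num» in codimensions `r`, `n − r` all hold (`2r ≠ n`)

Topic `Literature/AlgebraicGeometry/Motives`; THEOREMS ONLY (no definition, no instance, no named fact; D-0026).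
Tate 1994 Th. 2.9 ∕ Milne 2007 Th. 1.2 ∕ Kahn 2020 Th. 6.53 («the order of the pole of `Z(X, t)` at `t = q^{−r}` equals
the rank of the group of numerical equivalence classes of codimension-`r` cycles» ⟹ `Tʳ ∧ T^{d−r} ∧ Sʳ` and hom = num),
made unconditional — granted RH for `X` in `E` — for the diagonal hypersurface off the middle: `H^{2r}(X)` is the LINE
`K·ηʳ` (g49-#5), so the generalised `1`-eigenspace of `φ_r` has dimension `≤ 1`, while the intersection pairing on
`Aʳ(X) × A^{n−r}(X) ∋ (ηʳ, η^{n−r})` has rank `≥ 1` (`ηʳ·η^{n−r} = deg X ≠ 0`); the tree's inequalities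
`rank ≤ dim (gen. eigenspace) = pole order` (`rank_le_finrank_maxGenEigenspace`, `hasPoleOfOrderAt_zetaSeries`) close up.

* **`finrank_maxGenEigenspace_diagonalHypersurface_of_ne`** — `dim_K H^{2r}(X)(r)_1 = 1` (`2r ≠ n`, `r ≤ n`);
  **`hasPoleOfOrderAt_zetaSeries_diagonalHypersurface_of_ne`** — `Z(X,T)` has a pole of order exactly `1` at `q^{−r}`;
* **`consequences_diagonalHypersurface_of_ne`** — `Tʳ(X) ∧ T^{n−r}(X) ∧ (Ker ⊓ Im)(φ_r − 1) = ⊥ ∧ (Ker ⊓ Im)(φ_{n−r} − 1) = ⊥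
  ∧` numerically trivial ⟹ homologically trivial in codimensions `r` and `n − r`;
  `isHomologicallyTrivial_of_isNumericallyTrivial_diagonalHypersurface_of_ne` (the hom = num clause alone).

In a Galois Weil cohomology `E` over `𝔽_q` with the Lefschetz trace formula, `χ(φ) = q`, granted RH for `X` in `E`
(`n ≥ 1`).  The middle codimension `2r = n` (Tate's theorem for Fermat hypersurfaces via lines ∕ Shioda's inductive
structure) is NOT here; for quadrics with `(Δ/𝔽_q) = −1` see `Motives/DiagonalQuadricTateConjecture` (g49-#13).

## References

* [Tate1994] J. Tate, Conjectures on algebraic cycles in ℓ-adic cohomology (1994), §1 Conjecture Tʳ, §2 Th. 2.9.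
* [Kahn2020] B. Kahn, Zeta and L-Functions of Varieties and Motives (2020), §6.14 Conj. 6.52, Th. 6.53.
* [Weil1949] A. Weil, Bull. AMS 55 (1949), p. 507 (`B_{2j} = 1` off the middle).
* Tree: `Motives/ZetaFunctionPoleOrderTateConjecture` (`hasPoleOfOrderAt_zetaSeries`, `rank_le_finrank_maxGenEigenspace`,
  `consequences_of_hasPoleOfOrderAt_zetaSeries`), `Kahn2003/RationalNumericalEquivalenceOfTate` (`HasPoleOfOrderAt`),
  `Motives/DiagonalHypersurfaceFiniteFieldCohomology` (g49-#5 `finrank_diagonalHypersurface_of_ne`), hyperplane-class API.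

## Provenance

Lane `lit-hodgefound` (summit `HodgeConjecture`, Track 2 foundations library, Layer B: motives / Tate's conjecture over
finite fields), seat `lit-hodgefound-p29` (literature-prover, generation 49, row g49-#14).
-/

universe u v

open Polynomial Finset
open Literature.AlgebraicGeometry.Kahn2003 (HasPoleOfOrderAt)

noncomputable section

namespace Literature.AlgebraicGeometry.Motives

namespace GaloisWeilCohomology

open SmoothHypersurface

variable {k : Type u} [Field k] [Finite k] {K : Type v} [Field K] [CharZero K]
  {χ : Field.absoluteGaloisGroup k →* Kˣ} (E : GaloisWeilCohomology k K χ)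
variable {n d : ℕ} {β : Fin (n + 2) → kˣ}

/-- **`dim_K H^{2r}(X)(r)_1 = 1` and the intersection pairing on `Aʳ × A^{n−r}` has rank `1`, off the middle**
(`2r ≠ n`, `r + s = n`): `rank ≤ dim ≤ b_{2r} = 1 ≤ rank` (`ηʳ·ηˢ = deg X ≠ 0`).  In a Galois Weil cohomology `E` with
the trace formula, `χ(φ) = q`, granted RH for `X` in `E`. [cite: Tate1994, §2 Th. 2.9] [cite: Weil1949, p. 507] -/
theorem finrank_maxGenEigenspace_diagonalHypersurface_of_ne (hE : E.HasLefschetzTraceFormula)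
    (hχ : ((χ (arithFrob k) : Kˣ) : K) = Nat.card k) (hn : 0 < n) (hd : d ∣ Nat.card k - 1)
    (hRH : E.WeilRiemannHypothesisFor
      (hypersurface (∑ i, MvPolynomial.C (β i : k) * MvPolynomial.X i ^ d : MvPolynomial (Fin (n + 2)) k)) n)
    {r s : ℕ} (hrs : r + s = n) (hr : 2 * r ≠ n) (h : 2 * r + 2 * s = 2 * n) :
    Module.finrank K (Module.End.maxGenEigenspace (E.ρTwist
        (hypersurface (∑ i, MvPolynomial.C (β i : k) * MvPolynomial.X i ^ d : MvPolynomial (Fin (n + 2)) k))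
        (2 * r) r (geomFrob k)) 1) = 1 ∧
      Module.finrank K (LinearMap.range ((E.cupPairing
        (hypersurface (∑ i, MvPolynomial.C (β i : k) * MvPolynomial.X i ^ d : MvPolynomial (Fin (n + 2)) k))
        n (2 * r) (2 * s) h).domRestrict₁₂
        (E.algebraicClasses (hypersurface (∑ i, MvPolynomial.C (β i : k) * MvPolynomial.X i ^ d :
          MvPolynomial (Fin (n + 2)) k)) r)
        (E.algebraicClasses (hypersurface (∑ i, MvPolynomial.C (β i : k) * MvPolynomial.X i ^ d :
          MvPolynomial (Fin (n + 2)) k)) s))) = 1 := by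
  set Y := hypersurface (∑ i, MvPolynomial.C (β i : k) * MvPolynomial.X i ^ d : MvPolynomial (Fin (n + 2)) k)
    with hY
  have hX : IsSmoothProjective n Y := isSmoothProjective_diagonalHypersurface_of_dvd hn hd β
  haveI := E.finite_obj hX (2 * r)
  haveI := E.finite_obj hX (2 * s)
  -- `dim ≤ b_{2r} = 1`
  have hone : Module.finrank K (E.obj Y (2 * r)) = 1 := by
    rw [E.finrank_diagonalHypersurface_of_ne hE hχ hn hd hRH hr, if_pos ⟨even_two_mul r, by omega⟩]
  have hμle : Module.finrank K (Module.End.maxGenEigenspace (E.ρTwist Y (2 * r) r (geomFrob k)) 1) ≤ 1 := by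
    rw [← hone]
    exact Submodule.finrank_le _
  -- `rank ≤ dim`
  have hρle := E.rank_le_finrank_maxGenEigenspace hX h
  -- `rank ≥ 1`
  have hρge : 1 ≤ Module.finrank K (LinearMap.range ((E.cupPairing Y n (2 * r) (2 * s) h).domRestrict₁₂
      (E.algebraicClasses Y r) (E.algebraicClasses Y s))) := by
    rw [Submodule.one_le_finrank_iff]
    obtain ⟨η, hη, hne0⟩ := E.exists_isHyperplaneClass_pow_ne_zero hX hn
    obtain ⟨deg, hdeg, htr⟩ := E.trace_pow_of_isHyperplaneClass hX η hη
    have hmr : E.pow Y η r ∈ E.algebraicClasses Y r :=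
      E.pow_mem_algebraicClasses hX (E.hyperplaneClass_mem_algebraicClasses hX hη) r
    have hms : E.pow Y η s ∈ E.algebraicClasses Y s :=
      E.pow_mem_algebraicClasses hX (E.hyperplaneClass_mem_algebraicClasses hX hη) s
    intro hbot
    have hzero : (E.cupPairing Y n (2 * r) (2 * s) h).domRestrict₁₂ (E.algebraicClasses Y r)
        (E.algebraicClasses Y s) ⟨E.pow Y η r, hmr⟩ = 0 := by
      have : (E.cupPairing Y n (2 * r) (2 * s) h).domRestrict₁₂ (E.algebraicClasses Y r)
          (E.algebraicClasses Y s) ⟨E.pow Y η r, hmr⟩ ∈ LinearMap.range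
          ((E.cupPairing Y n (2 * r) (2 * s) h).domRestrict₁₂ (E.algebraicClasses Y r)
            (E.algebraicClasses Y s)) := LinearMap.mem_range_self _ _
      rw [hbot] at this
      exact (Submodule.mem_bot K).mp this
    have happ := LinearMap.congr_fun hzero ⟨E.pow Y η s, hms⟩
    rw [LinearMap.domRestrict₁₂_apply, LinearMap.zero_apply, PreWeilCohomology.cupPairing, LinearMap.compr₂_apply,
      E.cup_pow_pow hX η r s n hrs h, htr] at happ
    exact (Nat.cast_ne_zero.mpr hdeg.ne') happ
  exact ⟨le_antisymm hμle (hρge.trans hρle), le_antisymm (hρle.trans hμle) hρge⟩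

/-- **`Z(X, T)` has a pole of order exactly `1` at `T = q^{−r}` for every `r ≤ n` with `2r ≠ n`** (diagonal
hypersurface, `d ∣ q − 1`, `n ≥ 1`; RH for `X` in `E`): the pole order is `dim_K H^{2r}(X)(r)_1 = 1`.
[cite: Kahn2020, §6.14 Conj. 6.52] [cite: Tate1994, §2 Th. 2.9] [cite: Weil1949, p. 507] -/
theorem hasPoleOfOrderAt_zetaSeries_diagonalHypersurface_of_ne (hE : E.HasLefschetzTraceFormula)
    (hχ : ((χ (arithFrob k) : Kˣ) : K) = Nat.card k) (hn : 0 < n) (hd : d ∣ Nat.card k - 1)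
    (hRH : E.WeilRiemannHypothesisFor
      (hypersurface (∑ i, MvPolynomial.C (β i : k) * MvPolynomial.X i ^ d : MvPolynomial (Fin (n + 2)) k)) n)
    {r : ℕ} (hrn : r ≤ n) (hr : 2 * r ≠ n) :
    HasPoleOfOrderAt (zetaSeries (hypersurface (∑ i, MvPolynomial.C (β i : k) * MvPolynomial.X i ^ d :
      MvPolynomial (Fin (n + 2)) k))) (((Nat.card k : ℚ) ^ r)⁻¹) 1 := by
  have hX := isSmoothProjective_diagonalHypersurface_of_dvd hn hd β
  have hμ := E.hasPoleOfOrderAt_zetaSeries hE hχ hX hRH hrn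
  rwa [(E.finrank_maxGenEigenspace_diagonalHypersurface_of_ne hE hχ hn hd hRH (s := n - r) (by omega) hr
    (by omega)).1] at hμ

/-- **Tate's `Tʳ(X)`, `T^{n−r}(X)`, the semisimplicity of the eigenvalue `1` of `φ_r`, `φ_{n−r}`, and hom = num in
codimensions `r`, `n − r` — for the diagonal hypersurface off the middle** (`r + s = n`, `2r ≠ n`; `d ∣ q − 1`,
`n ≥ 1`): the pole of `Z(X, T)` at `q^{−r}` has order exactly the rank of the intersection pairing on `Aʳ × Aˢ`
(both `= 1`), which is hypothesis (c) of Tate's Th. 2.9 (tree `consequences_of_hasPoleOfOrderAt_zetaSeries`).  In a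
Galois Weil cohomology `E` with the trace formula, `χ(φ) = q`, granted RH for `X` in `E`.
[cite: Tate1994, §2 Th. 2.9] [cite: Kahn2020, §6.14 Th. 6.53] [cite: Weil1949, p. 507] -/
theorem consequences_diagonalHypersurface_of_ne (hE : E.HasLefschetzTraceFormula)
    (hχ : ((χ (arithFrob k) : Kˣ) : K) = Nat.card k) (hn : 0 < n) (hd : d ∣ Nat.card k - 1)
    (hRH : E.WeilRiemannHypothesisFor
      (hypersurface (∑ i, MvPolynomial.C (β i : k) * MvPolynomial.X i ^ d : MvPolynomial (Fin (n + 2)) k)) n)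
    {r s : ℕ} (hrs : r + s = n) (hr : 2 * r ≠ n) :
    E.TateConjectureFor
        (hypersurface (∑ i, MvPolynomial.C (β i : k) * MvPolynomial.X i ^ d : MvPolynomial (Fin (n + 2)) k)) r ∧
      E.TateConjectureFor
        (hypersurface (∑ i, MvPolynomial.C (β i : k) * MvPolynomial.X i ^ d : MvPolynomial (Fin (n + 2)) k)) s ∧
      LinearMap.ker (E.ρTwist (hypersurface (∑ i, MvPolynomial.C (β i : k) * MvPolynomial.X i ^ d :
            MvPolynomial (Fin (n + 2)) k)) (2 * r) r (geomFrob k) - 1) ⊓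
          LinearMap.range (E.ρTwist (hypersurface (∑ i, MvPolynomial.C (β i : k) * MvPolynomial.X i ^ d :
            MvPolynomial (Fin (n + 2)) k)) (2 * r) r (geomFrob k) - 1) = ⊥ ∧
      LinearMap.ker (E.ρTwist (hypersurface (∑ i, MvPolynomial.C (β i : k) * MvPolynomial.X i ^ d :
            MvPolynomial (Fin (n + 2)) k)) (2 * s) s (geomFrob k) - 1) ⊓
          LinearMap.range (E.ρTwist (hypersurface (∑ i, MvPolynomial.C (β i : k) * MvPolynomial.X i ^ d :
            MvPolynomial (Fin (n + 2)) k)) (2 * s) s (geomFrob k) - 1) = ⊥ ∧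
      (∀ c : AlgebraicGeometry.AlgebraicCycle (hypersurface (∑ i, MvPolynomial.C (β i : k) * MvPolynomial.X i ^ d :
          MvPolynomial (Fin (n + 2)) k)).left ℤ,
        E.IsNumericallyTrivial n (hypersurface (∑ i, MvPolynomial.C (β i : k) * MvPolynomial.X i ^ d :
            MvPolynomial (Fin (n + 2)) k)) r c →
          E.IsHomologicallyTrivial (hypersurface (∑ i, MvPolynomial.C (β i : k) * MvPolynomial.X i ^ d :
            MvPolynomial (Fin (n + 2)) k)) r c) ∧
      ∀ c : AlgebraicGeometry.AlgebraicCycle (hypersurface (∑ i, MvPolynomial.C (β i : k) * MvPolynomial.X i ^ d :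
          MvPolynomial (Fin (n + 2)) k)).left ℤ,
        E.IsNumericallyTrivial n (hypersurface (∑ i, MvPolynomial.C (β i : k) * MvPolynomial.X i ^ d :
            MvPolynomial (Fin (n + 2)) k)) s c →
          E.IsHomologicallyTrivial (hypersurface (∑ i, MvPolynomial.C (β i : k) * MvPolynomial.X i ^ d :
            MvPolynomial (Fin (n + 2)) k)) s c := by
  have hX := isSmoothProjective_diagonalHypersurface_of_dvd hn hd β
  have h : 2 * r + 2 * s = 2 * n := by omega
  obtain ⟨hμ1, hρ1⟩ := E.finrank_maxGenEigenspace_diagonalHypersurface_of_ne hE hχ hn hd hRH hrs hr h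
  have hμ := E.hasPoleOfOrderAt_zetaSeries hE hχ hX hRH (show r ≤ n by omega)
  rw [hμ1] at hμ
  have hc : HasPoleOfOrderAt (zetaSeries (hypersurface (∑ i, MvPolynomial.C (β i : k) * MvPolynomial.X i ^ d :
      MvPolynomial (Fin (n + 2)) k))) (((Nat.card k : ℚ) ^ r)⁻¹)
      (Module.finrank K (LinearMap.range ((E.cupPairing
        (hypersurface (∑ i, MvPolynomial.C (β i : k) * MvPolynomial.X i ^ d : MvPolynomial (Fin (n + 2)) k))
        n (2 * r) (2 * s) h).domRestrict₁₂
        (E.algebraicClasses (hypersurface (∑ i, MvPolynomial.C (β i : k) * MvPolynomial.X i ^ d :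
          MvPolynomial (Fin (n + 2)) k)) r)
        (E.algebraicClasses (hypersurface (∑ i, MvPolynomial.C (β i : k) * MvPolynomial.X i ^ d :
          MvPolynomial (Fin (n + 2)) k)) s)))) := by
    rw [hρ1]
    exact hμ
  exact E.consequences_of_hasPoleOfOrderAt_zetaSeries hE hχ hX hRH hrs h hc

/-- **Hom = num in every codimension `r ≠ n/2` of the diagonal hypersurface**: a numerically trivial algebraic cycle
of codimension `r` (`2r ≠ n`, `r ≤ n`) is homologically trivial in `E`. [cite: Tate1994, §2 Th. 2.9]
[cite: Kahn2020, §6.14 Th. 6.53] -/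
theorem isHomologicallyTrivial_of_isNumericallyTrivial_diagonalHypersurface_of_ne (hE : E.HasLefschetzTraceFormula)
    (hχ : ((χ (arithFrob k) : Kˣ) : K) = Nat.card k) (hn : 0 < n) (hd : d ∣ Nat.card k - 1)
    (hRH : E.WeilRiemannHypothesisFor
      (hypersurface (∑ i, MvPolynomial.C (β i : k) * MvPolynomial.X i ^ d : MvPolynomial (Fin (n + 2)) k)) n)
    {r : ℕ} (hrn : r ≤ n) (hr : 2 * r ≠ n)
    (c : AlgebraicGeometry.AlgebraicCycle (hypersurface (∑ i, MvPolynomial.C (β i : k) * MvPolynomial.X i ^ d :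
      MvPolynomial (Fin (n + 2)) k)).left ℤ)
    (hc : E.IsNumericallyTrivial n (hypersurface (∑ i, MvPolynomial.C (β i : k) * MvPolynomial.X i ^ d :
      MvPolynomial (Fin (n + 2)) k)) r c) :
    E.IsHomologicallyTrivial (hypersurface (∑ i, MvPolynomial.C (β i : k) * MvPolynomial.X i ^ d :
      MvPolynomial (Fin (n + 2)) k)) r c :=
  (E.consequences_diagonalHypersurface_of_ne hE hχ hn hd hRH (s := n - r) (by omega) hr).2.2.2.2.1 c hc

end GaloisWeilCohomology

end Literature.AlgebraicGeometry.Motives
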